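import Mathlib
import Summits.KontsevichZagierPeriods.Zeta5Search.Families.BasicGrowthRatio
import Summits.KontsevichZagierPeriods.Zeta5Search.Families.CellularBrownExamples
import HarnessLib

/-!
# ζ(5) search — Families: the growth constant of the five-point family is `((√5−1)/2)⁵` (worked example)

HONEST FRAMING: systematic search; no irrationality claim unless certified.  STRUCTURAL/ELEMENTARY: the growth
constant `M_σ = sup_S f_σ` of `Families/BasicGrowth.lean` is COMPUTED EXACTLY for Brown's `N = 5` configuration
`₅π = (5,2,4,1,3)` (`sigma5`, Dixon/Rhin–Viola/Beukers-type `ζ(2)` integrals [Brown2016, §5.3.1]):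
**`fSup sigma5 = ((√5 − 1)/2)⁵ = φ⁻⁵ = 0.0901699…`** (`fSup_sigma5`), Beukers' classical constant.  Consequences
(F30–F32 instances): `I_{₅π}(N)^{1/N} → φ⁻⁵` (`tendsto_five_root`), `I_{₅π}(N) ≤ φ^{−5N} I_{₅π}(0)`, every ratio
`I(N+1)/I(N) ≤ φ⁻⁵`.  Nothing arithmetic (no linear forms in `ζ(2)`, no denominators).

Proof.  In simplicial coordinates `f_σ(t₁,t₂) = t₁(t₂−t₁)(1−t₂) / ((1−t₁) t₂)` (`fSigma_sigma5`).  With `u = t₁`,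
`v = 1 − t₂`, `m = (u+v)/2`: AM–GM `uv ≤ m²` gives `f ≤ m²(1−2m)/(1−m)²` (`five_step_one`), and the one-variable bound
`m²(1−2m) ≤ φ⁻⁵ (1−m)²` is the polynomial identity
`φ⁻⁵(1−m)² − m²(1−2m) = 2(m − m₀)²(m + (√5−1)/4)` with `m₀ = (3−√5)/2 = φ⁻²` (`five_key_identity`, using only
`(√5)² = 5`); equality at the interior point `t* = (φ⁻², φ⁻¹)`.  Seat P2, Families layer.  Standard axioms only.
-/

noncomputable section

open MeasureTheory Set Finset Filter Topology

namespace Summit.KontsevichZagierPeriods.Zeta5Search.Families.Cellular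

open Literature.NumberTheory.Irrationality

/-! ### The five-point configuration -/

/-- `sigma5` is a bijection of `Fin 5`. -/
theorem sigma5_bijective : Function.Bijective sigma5 := Finite.injective_iff_bijective.1 sigma5_eq_ofSeating.2.2

/-- `₅π` is convergent (Brown's dinner-party condition). -/
theorem convergent_sigma5 : Convergent sigma5 :=
  (brownConvergent_basic_iff_convergent sigma5_bijective le_rfl).1
    (by have h := (brownConvergent_five_iff (fun _ => (0 : ℤ))).2 (fun _ => le_rfl)
        have e : den5 (fun _ => (0 : ℤ)) = fun _ => 0 := by ext i; fin_cases i <;> simp [den5]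
        rwa [e] at h)

/-- The open simplex for `ℓ = 2`: `0 < t₀ < t₁ < 1`. -/
theorem mem_openSimplex_two (t : Fin 2 → ℝ) : t ∈ openSimplex 2 ↔ 0 < t 0 ∧ t 0 < t 1 ∧ t 1 < 1 := by
  simp [openSimplex, Fin.forall_fin_succ, pt]

/-- Brown's `f_σ` for `₅π` in simplicial coordinates: `t₁(t₂−t₁)(1−t₂) / ((1−t₁)t₂)`. [Brown2016, §5.3.1] -/
theorem fSigma_sigma5 (t : Fin 2 → ℝ) :
    fSigma sigma5 t = t 0 * (t 1 - t 0) * (1 - t 1) / ((1 - t 0) * t 1) := by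
  simp [fSigma, formDen, Fin.prod_univ_five, sigma5, ef, pt, max_def, min_def]

/-! ### The constant and the key polynomial identity -/

/-- `0 < m₀ < 1/2` for the critical value `m₀ = (3 − √5)/2` (i.e. `2 < √5 < 3`). -/
theorem mZero_bounds : 0 < (3 - Real.sqrt 5) / 2 ∧ (3 - Real.sqrt 5) / 2 < 1 / 2 := by
  have h2 : (2 : ℝ) < Real.sqrt 5 := by
    rw [show (2 : ℝ) = Real.sqrt 4 by rw [show (4 : ℝ) = 2 ^ 2 by norm_num, Real.sqrt_sq (by norm_num)]]
    exact Real.sqrt_lt_sqrt (by norm_num) (by norm_num)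
  have h3 : Real.sqrt 5 < 3 := by
    rw [show (3 : ℝ) = Real.sqrt 9 by rw [show (9 : ℝ) = 3 ^ 2 by norm_num, Real.sqrt_sq (by norm_num)]]
    exact Real.sqrt_lt_sqrt (by norm_num) (by norm_num)
  constructor <;> linarith

/-- `((√5−1)/2)⁵ = (5√5 − 11)/2`. -/
theorem phiInv_pow_five : ((Real.sqrt 5 - 1) / 2) ^ 5 = (5 * Real.sqrt 5 - 11) / 2 := by
  have h : Real.sqrt 5 ^ 2 = 5 := Real.sq_sqrt (by norm_num)
  linear_combination (Real.sqrt 5 ^ 3 - 5 * Real.sqrt 5 ^ 2 + 15 * Real.sqrt 5 - 35) / 32 * h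

/-- **Key identity**: `K(1−m)² − m²(1−2m) = 2(m − m₀)²(m + (√5−1)/4)` with `K = (5√5−11)/2 = ((√5−1)/2)⁵` and
`m₀ = (3−√5)/2`. -/
theorem five_key_identity (m : ℝ) :
    (5 * Real.sqrt 5 - 11) / 2 * (1 - m) ^ 2 - m ^ 2 * (1 - 2 * m) =
      2 * (m - (3 - Real.sqrt 5) / 2) ^ 2 * (m + (Real.sqrt 5 - 1) / 4) := by
  have h : Real.sqrt 5 ^ 2 = 5 := Real.sq_sqrt (by norm_num)
  linear_combination (-m + (7 - Real.sqrt 5) / 8) * h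

/-- The one-variable bound: `m²(1−2m) ≤ ((√5−1)/2)⁵ (1−m)²` for `0 ≤ m`. -/
theorem five_step_two {m : ℝ} (hm : 0 ≤ m) :
    m ^ 2 * (1 - 2 * m) ≤ ((Real.sqrt 5 - 1) / 2) ^ 5 * (1 - m) ^ 2 := by
  rw [phiInv_pow_five]
  have h := five_key_identity m
  have hpos : 0 ≤ 2 * (m - (3 - Real.sqrt 5) / 2) ^ 2 * (m + (Real.sqrt 5 - 1) / 4) := by
    have hs1 : 0 < m + (Real.sqrt 5 - 1) / 4 := by linarith [mZero_bounds.2]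
    exact mul_nonneg (mul_nonneg two_pos.le (sq_nonneg _)) hs1.le
  linarith

/-- The AM–GM step: `uv(1−u−v)/((1−u)(1−v)) ≤ m²(1−2m)/(1−m)²` with `m = (u+v)/2`, for `u, v > 0`, `u + v < 1`. -/
theorem five_step_one {u v : ℝ} (hu : 0 < u) (hv : 0 < v) (huv : u + v < 1) :
    u * v * (1 - u - v) / ((1 - u) * (1 - v)) ≤
      ((u + v) / 2) ^ 2 * (1 - 2 * ((u + v) / 2)) / (1 - (u + v) / 2) ^ 2 := by
  have h1 : 0 < 1 - u := by linarith
  have h2 : 0 < 1 - v := by linarith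
  have hm : 0 < 1 - (u + v) / 2 := by linarith
  rw [div_le_div_iff₀ (mul_pos h1 h2) (pow_pos hm 2)]
  have hamgm : u * v ≤ ((u + v) / 2) ^ 2 := by nlinarith [sq_nonneg (u - v)]
  have hw : 0 < 1 - u - v := by linarith
  -- `(1−u)(1−v) = (1 − u − v) + uv`
  nlinarith [mul_nonneg hw.le (sub_nonneg.2 hamgm), mul_pos hu hv, sq_nonneg (u - v), hw]

/-- **`f_{₅π} ≤ ((√5−1)/2)⁵` on the open simplex.** -/
theorem fSigma_sigma5_le {t : Fin 2 → ℝ} (ht : t ∈ openSimplex 2) :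
    fSigma sigma5 t ≤ ((Real.sqrt 5 - 1) / 2) ^ 5 := by
  obtain ⟨h0, h01, h1⟩ := (mem_openSimplex_two t).1 ht
  rw [fSigma_sigma5]
  -- substitute `u = t 0`, `v = 1 - t 1`
  have hv : 0 < 1 - t 1 := by linarith
  have huv : t 0 + (1 - t 1) < 1 := by linarith
  have hs := five_step_one h0 hv huv
  have e1 : t 0 * (1 - t 1) * (1 - t 0 - (1 - t 1)) / ((1 - t 0) * (1 - (1 - t 1))) =
      t 0 * (t 1 - t 0) * (1 - t 1) / ((1 - t 0) * t 1) := by ring_nf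
  rw [e1] at hs
  refine hs.trans ?_
  set m := (t 0 + (1 - t 1)) / 2 with hm
  have hm0 : 0 ≤ m := by rw [hm]; linarith
  have hm1 : 0 < (1 - m) ^ 2 := by apply pow_pos; rw [hm]; linarith
  rw [div_le_iff₀ hm1]
  exact five_step_two hm0

/-- The maximiser `t* = (m₀, 1 − m₀)`, `m₀ = (3−√5)/2 = φ⁻²`, lies in the open simplex. -/
theorem tStar_mem : (![(3 - Real.sqrt 5) / 2, 1 - (3 - Real.sqrt 5) / 2] : Fin 2 → ℝ) ∈ openSimplex 2 := by
  rw [mem_openSimplex_two]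
  obtain ⟨h2, h3⟩ := mZero_bounds
  simp only [Matrix.cons_val_zero, Matrix.cons_val_one]
  refine ⟨by linarith, by linarith, by linarith⟩

/-- At `t*` the value of `f_{₅π}` is exactly `((√5−1)/2)⁵`. -/
theorem fSigma_sigma5_tStar :
    fSigma sigma5 ![(3 - Real.sqrt 5) / 2, 1 - (3 - Real.sqrt 5) / 2] = ((Real.sqrt 5 - 1) / 2) ^ 5 := by
  rw [fSigma_sigma5, phiInv_pow_five]
  simp only [Matrix.cons_val_zero, Matrix.cons_val_one]
  obtain ⟨h2, h3⟩ := mZero_bounds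
  set m := (3 - Real.sqrt 5) / 2 with hm
  have hden : (1 - m) * (1 - m) ≠ 0 := by
    apply mul_ne_zero <;> (intro h; linarith)
  have e : m * (1 - m - m) * (1 - (1 - m)) = m ^ 2 * (1 - 2 * m) := by ring
  rw [e, div_eq_iff hden]
  -- the key identity at `m = m₀` has vanishing right-hand side
  have h := five_key_identity m
  have h0 : 2 * (m - (3 - Real.sqrt 5) / 2) ^ 2 * (m + (Real.sqrt 5 - 1) / 4) = 0 := by rw [hm]; ring
  rw [h0] at h
  linarith

/-! ### The growth constant of the five-point family -/

/-- **`M_{₅π} = ((√5−1)/2)⁵`**: the growth constant of Brown's five-point family (Beukers' `ζ(2)` constant `φ⁻⁵`).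
[Brown2016, §5.3.1 objects; structural/elementary] -/
theorem fSup_sigma5 : fSup sigma5 = ((Real.sqrt 5 - 1) / 2) ^ 5 := by
  apply le_antisymm
  · exact fSup_le_of_forall_le sigma5 fun t ht => fSigma_sigma5_le ht
  · rw [← fSigma_sigma5_tStar]
    exact fSigma_le_fSup sigma5 sigma5_bijective tStar_mem

/-- The same constant as `φ⁻⁵` with Mathlib's golden ratio. -/
theorem fSup_sigma5_eq_goldenRatio_inv_pow : fSup sigma5 = Real.goldenRatio⁻¹ ^ 5 := by
  rw [fSup_sigma5, Real.inv_goldenRatio, Real.goldenConj]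
  ring

/-- **`I_{₅π}(N)^{1/N} → ((√5−1)/2)⁵`**: the exact root asymptotics of the five-point basic cellular integrals. -/
theorem tendsto_five_root :
    Tendsto (fun N : ℕ => (integral sigma5 (fun _ => (N : ℤ)) (fun _ => (N : ℤ))) ^ (1 / (N : ℝ))) atTop
      (𝓝 (((Real.sqrt 5 - 1) / 2) ^ 5)) := by
  rw [← fSup_sigma5]
  exact tendsto_integral_basic_root sigma5 sigma5_bijective convergent_sigma5

/-- `I_{₅π}(N) ≤ ((√5−1)/2)^{5N} · I_{₅π}(0)`. -/
theorem integral_five_le (N : ℕ) :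
    integral sigma5 (fun _ => (N : ℤ)) (fun _ => (N : ℤ)) ≤
      (((Real.sqrt 5 - 1) / 2) ^ 5) ^ N * integral sigma5 (fun _ => (0 : ℤ)) (fun _ => (0 : ℤ)) := by
  rw [← fSup_sigma5]
  exact integral_basic_le_fSup_pow sigma5 sigma5_bijective N

/-- Every ratio `I_{₅π}(N+1)/I_{₅π}(N)` is at most `((√5−1)/2)⁵`, and the ratios converge to it. -/
theorem integral_five_ratio_le (N : ℕ) :
    integral sigma5 (fun _ => ((N + 1 : ℕ) : ℤ)) (fun _ => ((N + 1 : ℕ) : ℤ)) /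
      integral sigma5 (fun _ => (N : ℤ)) (fun _ => (N : ℤ)) ≤ ((Real.sqrt 5 - 1) / 2) ^ 5 := by
  rw [← fSup_sigma5]
  exact integral_basic_ratio_le_fSup sigma5 sigma5_bijective convergent_sigma5 N

/-- `I_{₅π}(N+1)/I_{₅π}(N) → ((√5−1)/2)⁵`. -/
theorem tendsto_five_ratio :
    Tendsto (fun N : ℕ => integral sigma5 (fun _ => ((N + 1 : ℕ) : ℤ)) (fun _ => ((N + 1 : ℕ) : ℤ)) /
      integral sigma5 (fun _ => (N : ℤ)) (fun _ => (N : ℤ))) atTop (𝓝 (((Real.sqrt 5 - 1) / 2) ^ 5)) := by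
  rw [← fSup_sigma5]
  exact tendsto_integral_basic_ratio sigma5 sigma5_bijective convergent_sigma5

end Summit.KontsevichZagierPeriods.Zeta5Search.Families.Cellular
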